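import Summits.KontsevichZagierPeriods.KontsevichZagierPeriods.Theorems.RootDecompRationalCubeDichotomySimpleBranchReImGreen

/-!
# Route RootDecompRationalCubeDichotomy — item 27842 `PiRationalisationSimpleBranch` PROVED, part 6/11 (`RootDecompRationalCubeDichotomySimpleBranchResidue`)

Theorems-split (≤ 400 lines each, sequential imports) of the decomp-kz lens-2 gen-4 file
`run/shared/lean/pub/decomp-kz/decomp-kz-lens-2/g4/PiRationalisationSimpleBranch27842.lean` (2963 lines; lens farm rc 0, writer re-check
rc 0 audit proof-of-item closed:true, critic g2 by-name probe std axioms, 2026-08-30T05:27:57Z/06:02:52Z). The rung: for simple-branch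
Nash data (`F(x,g) = 0`, `∂_z F(x,g) ≠ 0` on the closed cube) `[π]^K·[s] ∈ relations ⊔ ⟨rational closed-cube sector⟩` for all `K ≥ 1` —
root isolation on rational sub-boxes, the Green band move (planar Stokes inside the four moves), the half winding number ≡ 4[A] ≡ [π],
box rescaling, and `PiTimesSector` (item 26388, landed). The final part closes the ROUTE ITEM by name
(`piRationalisationSimpleBranch_proof`). Sector lemmas are REUSED from the landed rung-24903 file `…PiRationalisationSqrtMoves`.
[Kontsevich–Zagier 2001 §1.2; argument principle] Standard axioms, 0 sorry.
-/

noncomputable section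

set_option linter.dupNamespace false

namespace Summit.KontsevichZagierPeriods.RootDecompRationalCubeDichotomy.Rung27842.ReIm

open MvPolynomial
variable {n : ℕ}

/-! ### 5d. The Green band move for `Re/Im (N/D)` at the graph point `(x, g x, u, v)` -/

/-- Graph-parameter point: `(x,u,v) ↦ (x, g x, u, v)`. -/
def gpt (g : (Fin n → ℝ) → ℝ) (w : Fin (n + 2) → ℝ) : Fin (n + 3) → ℝ :=
  Fin.snoc (Fin.snoc (Fin.snoc (Fin.init (Fin.init w)) (g (Fin.init (Fin.init w))) : Fin (n + 1) → ℝ)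
    (Fin.init w (Fin.last n)) : Fin (n + 2) → ℝ) (w (Fin.last (n + 1)))

/-- Auxiliary step `gpt_snoc`. [bookkeeping] -/
theorem gpt_snoc (g : (Fin n → ℝ) → ℝ) (y : Fin (n + 1) → ℝ) (t : ℝ) :
    gpt g (Fin.snoc y t) =
      Fin.snoc (Fin.snoc (Fin.snoc (Fin.init y) (g (Fin.init y)) : Fin (n + 1) → ℝ) (y (Fin.last n)) :
        Fin (n + 2) → ℝ) t := by
  simp only [gpt, Fin.init_snoc, Fin.snoc_last]

/-- Auxiliary step `gpt_snoc_snoc`. [bookkeeping] -/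
theorem gpt_snoc_snoc (g : (Fin n → ℝ) → ℝ) (x : Fin n → ℝ) (s v : ℝ) :
    gpt g (Fin.snoc (Fin.snoc x s : Fin (n + 1) → ℝ) v) =
      Fin.snoc (Fin.snoc (Fin.snoc x (g x) : Fin (n + 1) → ℝ) s : Fin (n + 2) → ℝ) v := by
  simp only [gpt, Fin.init_snoc, Fin.snoc_last]

open Literature.NumberTheory.Transcendental in
/-- `gpt g` is a ℚ-semialgebraic map on any semialgebraic set lying over the base `τ` of `g`. -/
theorem isSemialgebraicMapOn_gpt {g : (Fin n → ℝ) → ℝ} {τ : Set (Fin n → ℝ)} (hg : IsSemialgebraicFunOn ℚ τ g)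
    {s : Set (Fin (n + 2) → ℝ)} (hs : Literature.ModelTheory.ExponentialFields.IsSemialgebraic ℚ s)
    (hsτ : s ⊆ {w | Fin.init (Fin.init w) ∈ τ}) : IsSemialgebraicMapOn ℚ s (gpt g) := by
  refine IsSemialgebraicMapOn.of_forall hs fun j => ?_
  refine Fin.lastCases ?_ (fun j' => ?_) j
  · exact (isSemialgebraicFunOn_apply hs (Fin.last (n + 1))).congr (fun w _ => by simp [gpt])
  · refine Fin.lastCases ?_ (fun j'' => ?_) j'
    · exact (isSemialgebraicFunOn_apply hs (Fin.castSucc (Fin.last n))).congr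
        (fun w _ => by simp [gpt, Fin.init])
    · refine Fin.lastCases ?_ (fun i => ?_) j''
      · have h := (hg.comp_init (m := n)).comp_init_mono hs
          (fun w hw => by exact hsτ hw)
        exact h.congr (fun w _ => by simp [gpt])
      · exact (isSemialgebraicFunOn_apply hs (Fin.castSucc (Fin.castSucc i))).congr
          (fun w _ => by simp [gpt, Fin.init])

/-- Continuity of `gpt g` on a set over which `g ∘ init ∘ init` is continuous. -/
theorem continuousOn_gpt {g : (Fin n → ℝ) → ℝ} {s : Set (Fin (n + 2) → ℝ)}
    (hg : ContinuousOn (fun w : Fin (n + 2) → ℝ => g (Fin.init (Fin.init w))) s) : ContinuousOn (gpt g) s := by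
  refine continuousOn_pi.2 fun j => ?_
  refine Fin.lastCases ?_ (fun j' => ?_) j
  · simpa [gpt] using (continuous_apply (Fin.last (n + 1))).continuousOn
  · refine Fin.lastCases ?_ (fun j'' => ?_) j'
    · simpa [gpt, Fin.init] using (continuous_apply (Fin.castSucc (Fin.last n))).continuousOn
    · refine Fin.lastCases ?_ (fun i => ?_) j''
      · simpa [gpt] using hg
      · simpa [gpt, Fin.init] using (continuous_apply (Fin.castSucc (Fin.castSucc i))).continuousOn

open Literature.NumberTheory.Transcendental in
/-- The set where `D(X, u+iv) ≠ 0` is ℚ-semialgebraic. -/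
theorem isSemialgebraic_setOf_cplx_ne {m : ℕ} (D : MvPolynomial (Fin (m + 1)) ℚ) :
    Literature.ModelTheory.ExponentialFields.IsSemialgebraic ℚ {W : Fin (m + 2) → ℝ | aeval (cplxPoint W) D ≠ 0} := by
  have h := Literature.ModelTheory.ExponentialFields.isSemialgebraic_setOf_eval_ne_zero (k := ℚ) (R := ℝ)
    (reP D ^ 2 + imP D ^ 2)
  convert h using 1
  ext W
  simp only [Set.mem_setOf_eq, ne_eq]
  rw [← normSq_aeval_cplxPoint]
  constructor
  · intro hD h0; exact hD (Complex.normSq_eq_zero.1 (by exact_mod_cast h0))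
  · intro hN h0; exact hN (by rw [h0]; simp)

open Literature.NumberTheory.Transcendental in
/-- Auxiliary step `isSemialgebraicFunOn_ratRe_gpt`. [bookkeeping] -/
theorem isSemialgebraicFunOn_ratRe_gpt {g : (Fin n → ℝ) → ℝ} {τ : Set (Fin n → ℝ)} (hg : IsSemialgebraicFunOn ℚ τ g)
    (N D : MvPolynomial (Fin (n + 2)) ℚ) {s : Set (Fin (n + 2) → ℝ)}
    (hs : Literature.ModelTheory.ExponentialFields.IsSemialgebraic ℚ s) (hsτ : s ⊆ {w | Fin.init (Fin.init w) ∈ τ})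
    (hD : ∀ w ∈ s, aeval (cplxPoint (gpt g w)) D ≠ 0) :
    IsSemialgebraicFunOn ℚ s (fun w => ratRe N D (gpt g w)) :=
  IsSemialgebraicFunOn.comp_isSemialgebraicMapOn_holds
    (isSemialgebraicFunOn_ratRe N D (isSemialgebraic_setOf_cplx_ne D) (fun _ hW => hW))
    (isSemialgebraicMapOn_gpt hg hs hsτ) (fun w hw => hD w hw)

open Literature.NumberTheory.Transcendental in
/-- Auxiliary step `isSemialgebraicFunOn_ratIm_gpt`. [bookkeeping] -/
theorem isSemialgebraicFunOn_ratIm_gpt {g : (Fin n → ℝ) → ℝ} {τ : Set (Fin n → ℝ)} (hg : IsSemialgebraicFunOn ℚ τ g)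
    (N D : MvPolynomial (Fin (n + 2)) ℚ) {s : Set (Fin (n + 2) → ℝ)}
    (hs : Literature.ModelTheory.ExponentialFields.IsSemialgebraic ℚ s) (hsτ : s ⊆ {w | Fin.init (Fin.init w) ∈ τ})
    (hD : ∀ w ∈ s, aeval (cplxPoint (gpt g w)) D ≠ 0) :
    IsSemialgebraicFunOn ℚ s (fun w => ratIm N D (gpt g w)) :=
  IsSemialgebraicFunOn.comp_isSemialgebraicMapOn_holds
    (isSemialgebraicFunOn_ratIm N D (isSemialgebraic_setOf_cplx_ne D) (fun _ hW => hW))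
    (isSemialgebraicMapOn_gpt hg hs hsτ) (fun w hw => hD w hw)

/-- Auxiliary step `continuousOn_ratRe_gpt`. [bookkeeping] -/
theorem continuousOn_ratRe_gpt {g : (Fin n → ℝ) → ℝ} (N D : MvPolynomial (Fin (n + 2)) ℚ) {s : Set (Fin (n + 2) → ℝ)}
    (hg : ContinuousOn (fun w : Fin (n + 2) → ℝ => g (Fin.init (Fin.init w))) s)
    (hD : ∀ w ∈ s, aeval (cplxPoint (gpt g w)) D ≠ 0) : ContinuousOn (fun w => ratRe N D (gpt g w)) s :=
  (continuousOn_ratRe N D (s := gpt g '' s) (by rintro _ ⟨w, hw, rfl⟩; exact hD w hw)).comp (continuousOn_gpt hg)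
    (Set.mapsTo_image _ _)

/-- Auxiliary step `continuousOn_ratIm_gpt`. [bookkeeping] -/
theorem continuousOn_ratIm_gpt {g : (Fin n → ℝ) → ℝ} (N D : MvPolynomial (Fin (n + 2)) ℚ) {s : Set (Fin (n + 2) → ℝ)}
    (hg : ContinuousOn (fun w : Fin (n + 2) → ℝ => g (Fin.init (Fin.init w))) s)
    (hD : ∀ w ∈ s, aeval (cplxPoint (gpt g w)) D ≠ 0) : ContinuousOn (fun w => ratIm N D (gpt g w)) s :=
  (continuousOn_ratIm N D (s := gpt g '' s) (by rintro _ ⟨w, hw, rfl⟩; exact hD w hw)).comp (continuousOn_gpt hg)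
    (Set.mapsTo_image _ _)

open Literature.NumberTheory.Transcendental Literature.NumberTheory.Transcendental.KZ Set in
/-- **Green for `Im(r dz)`, `r = (N/D)(x, g x, ·)`** — polynomial data at the graph parameter `(x, g x)` of a
semialgebraic `g` continuous on the base: the move that kills the remainder of the argument principle on the inner square.
Same shape as `of_sub_of_mem_relations_green_rat` with every `ratRe/ratIm` evaluated at `gpt g w`. -/
theorem of_sub_of_mem_relations_green_rat_gpt {τ : Set (Fin n → ℝ)} {α β γ δ : (Fin n → ℝ) → ℝ}
    {g : (Fin n → ℝ) → ℝ} (hg : IsSemialgebraicFunOn ℚ τ g)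
    (N Dd : MvPolynomial (Fin (n + 2)) ℚ)
    (hα : IsSemialgebraicFunOn ℚ τ α) (hβ : IsSemialgebraicFunOn ℚ τ β)
    (hγ : IsSemialgebraicFunOn ℚ τ γ) (hδ : IsSemialgebraicFunOn ℚ τ δ)
    (hαβ : ∀ x ∈ τ, α x ≤ β x) (hγδ : ∀ x ∈ τ, γ x ≤ δ x)
    (rW : IntegralRep (n + 2)) (bP bQ : IntegralRep (n + 1))
    (hrWd : rW.domain = KZlog.band (KZlog.band τ α β) (fun y => γ (Fin.init y)) (fun y => δ (Fin.init y)))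
    (hD : ∀ w ∈ rW.domain, aeval (cplxPoint (gpt g w)) Dd ≠ 0)
    (hrWi : ∀ w ∈ rW.domain, rW.integrand w = ratRe (dNum N Dd) (dDen Dd) (gpt g w))
    (hbPd : bP.domain = KZlog.band τ α β)
    (hbPi : ∀ y ∈ bP.domain,
      bP.integrand y = ratIm N Dd (gpt g (Fin.snoc y (δ (Fin.init y)))) - ratIm N Dd (gpt g (Fin.snoc y (γ (Fin.init y)))))
    (hbQd : bQ.domain = KZlog.band τ γ δ)
    (hbQi : ∀ y ∈ bQ.domain, bQ.integrand y =
      ratRe N Dd (gpt g (Fin.snoc (Fin.snoc (Fin.init y) (β (Fin.init y)) : Fin (n + 1) → ℝ) (y (Fin.last n)))) -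
        ratRe N Dd (gpt g (Fin.snoc (Fin.snoc (Fin.init y) (α (Fin.init y)) : Fin (n + 1) → ℝ) (y (Fin.last n))))) :
    of bQ - of bP ∈ relations := by
  have hsτ : rW.domain ⊆ {w | Fin.init (Fin.init w) ∈ τ} := by
    intro w hw; rw [hrWd] at hw; exact hw.1.1
  have memV : ∀ y ∈ KZlog.band τ α β, ∀ t ∈ Icc (γ (Fin.init y)) (δ (Fin.init y)),
      (Fin.snoc y t : Fin (n + 2) → ℝ) ∈ rW.domain := by
    intro y hy t ht; rw [hrWd]; exact KZlog.snoc_mem_band.2 ⟨hy, ht⟩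
  have memH : ∀ y ∈ KZlog.band τ γ δ, ∀ s ∈ Icc (α (Fin.init y)) (β (Fin.init y)),
      (Fin.snoc (Fin.snoc (Fin.init y) s : Fin (n + 1) → ℝ) (y (Fin.last n)) : Fin (n + 2) → ℝ) ∈ rW.domain := by
    intro y hy s hs; rw [hrWd]
    refine KZlog.snoc_mem_band.2 ⟨KZlog.snoc_mem_band.2 ⟨hy.1, hs⟩, ?_⟩
    simpa using And.intro hy.2.1 hy.2.2
  have hDV : ∀ y ∈ KZlog.band τ α β, ∀ t ∈ Icc (γ (Fin.init y)) (δ (Fin.init y)),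
      aeval (cplxPoint (Fin.snoc (Fin.snoc (Fin.snoc (Fin.init y) (g (Fin.init y)) : Fin (n + 1) → ℝ)
        (y (Fin.last n)) : Fin (n + 2) → ℝ) t)) Dd ≠ 0 := by
    intro y hy t ht; have := hD _ (memV y hy t ht); rwa [gpt_snoc] at this
  have hDH : ∀ y ∈ KZlog.band τ γ δ, ∀ s ∈ Icc (α (Fin.init y)) (β (Fin.init y)),
      aeval (cplxPoint (Fin.snoc (Fin.snoc (Fin.snoc (Fin.init y) (g (Fin.init y)) : Fin (n + 1) → ℝ) s :
        Fin (n + 2) → ℝ) (y (Fin.last n)))) Dd ≠ 0 := by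
    intro y hy s hs; have := hD _ (memH y hy s hs); rwa [gpt_snoc_snoc] at this
  refine of_sub_of_mem_relations_green (fun w => ratIm N Dd (gpt g w)) (fun w => ratRe N Dd (gpt g w))
    hα hβ hγ hδ hαβ hγδ rW rW bP bQ hrWd rfl
    (isSemialgebraicFunOn_ratIm_gpt hg N Dd rW.isSemialgebraic_domain hsτ hD)
    (isSemialgebraicFunOn_ratRe_gpt hg N Dd rW.isSemialgebraic_domain hsτ hD)
    (fun y hy => ?_) (fun y hy t ht => ?_) (fun y hy => ?_) (fun y hy t ht => ?_)
    (fun _ _ => rfl) hbPd hbPi hbQd hbQi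
  · have : (fun t : ℝ => ratIm N Dd (gpt g (Fin.snoc y t))) =
        fun t => ratIm N Dd (Fin.snoc (Fin.snoc (Fin.snoc (Fin.init y) (g (Fin.init y)) : Fin (n + 1) → ℝ)
          (y (Fin.last n)) : Fin (n + 2) → ℝ) t) := funext fun t => by rw [gpt_snoc]
    rw [this]
    exact continuousOn_ratIm_vertical N Dd _ fun s hs => hDV y hy s hs
  · have : (fun s : ℝ => ratIm N Dd (gpt g (Fin.snoc y s))) =
        fun s => ratIm N Dd (Fin.snoc (Fin.snoc (Fin.snoc (Fin.init y) (g (Fin.init y)) : Fin (n + 1) → ℝ)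
          (y (Fin.last n)) : Fin (n + 2) → ℝ) s) := funext fun s => by rw [gpt_snoc]
    rw [this]
    refine (hasDerivAt_ratIm_vertical N Dd _ t (hDV y hy t (Ioo_subset_Icc_self ht))).congr_deriv ?_
    rw [hrWi _ (memV y hy t (Ioo_subset_Icc_self ht)), gpt_snoc]
  · have : (fun t : ℝ => ratRe N Dd (gpt g (Fin.snoc (Fin.snoc (Fin.init y) t : Fin (n + 1) → ℝ) (y (Fin.last n))))) =
        fun t => ratRe N Dd (Fin.snoc (Fin.snoc (Fin.snoc (Fin.init y) (g (Fin.init y)) : Fin (n + 1) → ℝ) t :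
          Fin (n + 2) → ℝ) (y (Fin.last n))) := funext fun t => by rw [gpt_snoc_snoc]
    rw [this]
    exact continuousOn_ratRe_horizontal N Dd _ _ fun s hs => hDH y hy s hs
  · have : (fun s : ℝ => ratRe N Dd (gpt g (Fin.snoc (Fin.snoc (Fin.init y) s : Fin (n + 1) → ℝ) (y (Fin.last n))))) =
        fun s => ratRe N Dd (Fin.snoc (Fin.snoc (Fin.snoc (Fin.init y) (g (Fin.init y)) : Fin (n + 1) → ℝ) s :
          Fin (n + 2) → ℝ) (y (Fin.last n))) := funext fun s => by rw [gpt_snoc_snoc]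
    rw [this]
    refine (hasDerivAt_ratRe_horizontal N Dd _ _ t (hDH y hy t (Ioo_subset_Icc_self ht))).congr_deriv ?_
    rw [hrWi _ (memH y hy t (Ioo_subset_Icc_self ht)), gpt_snoc_snoc]

end Summit.KontsevichZagierPeriods.RootDecompRationalCubeDichotomy.Rung27842.ReIm

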